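/-
Copyright (c) 2026 the pub-hodgecm-mathlib formalisation cell (harness21).  Prover seat hodgecm-mathlib-LH4-p05 (g3), req620 Track A «(D-RAM) FOUR-FRAME» squad
(unit U3_Laws; (KMS) ROAD «MODULO κ-STAGE B», κ-Stage A: the CLASS-BY-CLASS refinement of ★ (O2b) p14 `…DiagonalOrbitFibreCount` that the κ-twist (Oκ2b) consumes;
dealer LH4-plan (g11) WORD #20∕#21; plan `F0/P3c/LH4/LH4-p05/g3/PLAN-KMS-modKappaStageB.v1`).  2026-09-04.
-/
import Summits.HodgeConjecture.HodgeConjecture.Theorems.F0P3cDyRamDiagonalOrbitFibreCount      -- ★ (O2b) PART 3 p856017 (LH4-p14): brings PART 1 (index identity, coset representatives), PART 2 (transport, classes, decomposition), ★ M, ★ TorusDefs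
import Mathlib.Tactic.FieldSimp
import HarnessLib

/-!
# Crux `H413`, line LH4 «(D-RAM) FOUR-FRAME» road — unit U3_Laws (iii), MS∕KMS ROAD A Stage A, brick (O2b) CLASS BY CLASS:
# along a unit-torus orbit, the sign class `e` contributes ONE `H`-translate (`[S̃-stabiliser : H]` lattices) iff `w⁻¹c^{e} ∈ N(𝒯)·S_F(M₀)`, and `#good · [· : H] · [𝒰 : S_F] = 8 · [𝒯 : S̃]`

Cell `hodgecm-mathlib` (D-0151), FLOOR 0, crux item H413 = `stmt-HodgeConjecture-24833`, route of record `HCCMUnconditional`; squad F0∕P3c∕LH4 (req618∕req620); registered stubs served: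
`F0P3cDyRamFourFrameU3.stub_U3_stableModelSum` ∕ `stub_U3_kappaModelSum` (tree `Cruxes/H413/Lines/F0_P3c_DyRamFourFrame_U3_Laws.lean` ED. 7 :109 ∕ :407).  THEOREMS ONLY (no `def`,
no instance, no notation, no `sorry`); lane `--supports stmt-HodgeConjecture-24833` (count-neutral).

THE MATHEMATICS = ★ (O2b) (LH4-p14, `finsum_ncard_fibre_mul_relIndex_eq_of_exists`) steps (1)–(7) VERBATIM, but EXPORTED PER SIGN CLASS instead of summed over the eight
classes: `σ` an isometric involution, `|ϖ| = exp(−1)` with unit avatar `ϖu`, `c = ↑cU` a `σ`-fixed NON-NORM unit with the (NI2) dichotomy, `M₀` an `𝒪`-submodule with FINITE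
unit-torus orbit, `tv` a type whose polarisation fibre over `M₀` is one `S_F(M₀)`-coset (`hcoset`), a polarisation `D₁ = N(ϖu^{a₀})·w` (`w ∈ 𝒰`; ★ `exists_zpow_fixedUnit_decomposition`).
For each class `e`, the lattices `M` of the orbit `𝒯·M₀` for which `diag(ϖu^{a})·M` is a type-tv vertex of `diag(d_e)` for some (then unique, `a = a₀`) exponent form ONE translate of
the `H`-orbit of `M₀` (`H = 𝒯 ∩ N⁻¹(S_F(M₀))`, size `[latticeStabilizer M₀ : H]`) when `e` is GOOD — `w⁻¹c^{e} ∈ N(𝒯) ⊔ S_F(M₀)` — and the empty set otherwise (first conjunct);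
and PART 1's index identity reads `#{e good} · [latticeStabilizer M₀ : H] · [𝒰 : S_F(M₀)] = 8 · [𝒯 : S̃(M₀)]` (second conjunct).  Summing the first conjunct over `e` and using the
second gives back ★ PART 3; weighting the classes by `χ⁰_i(e)` gives (Oκ2b) (`…DiagonalKappaOrbitFibreCount`, this seat).
* `finsum_ncard_fibre_class_eq_and_index` — the two conjuncts above, for every polarised `M₀` with finite orbit and the one-coset property.
HONEST LABEL.  Count-neutral (`--supports`); nothing printed is asserted; (MS)∕(KMS) stay PROVER TARGETS; `HC_CM` is proved only modulo the 7 printed citations (2 remaining named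
inputs: hLiu418 = `stmt-HodgeConjecture-24832`, h413 = `stmt-HodgeConjecture-24833`) until rung 0 closes.

## References
* [Kottwitz1986BaseChangeUnits] R. E. Kottwitz, *Base change for unit elements of Hecke algebras*, Compositio Math. 60 (1986), §1 pp. 240–241.
* [Rogawski1990] J. D. Rogawski, *Automorphic Representations of Unitary Groups in Three Variables*, Ann. of Math. Stud. 123 (1990), §4.9 Prop. 4.9.1 (a) p. 55.
* [Serre1979] J.-P. Serre, *Local Fields*, GTM 67 (1979), Ch. V §3 (norm classes of units).
-/

set_option autoImplicit false

noncomputable section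

namespace Summit.HodgeConjecture.HodgeConjecture.Cruxes.H413.F0P3cDyRamDiagonalOrbitFibreClassCount

open Matrix
open Literature.NumberTheory.Automorphic Literature.NumberTheory.Automorphic.HermitianLattice
open Literature.NumberTheory.Automorphic.UnitaryLatticeTree
open Summit.HodgeConjecture.HodgeConjecture.Cruxes.H413.F0P3cDyRamDiagonalTorusDefs
open Summit.HodgeConjecture.HodgeConjecture.Cruxes.H413.F0P3cDyRamDiagonalOrbitFibreTransport
open Summit.HodgeConjecture.HodgeConjecture.Cruxes.H413.F0P3cDyRamTorusRepresentativesCount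
open Summit.HodgeConjecture.HodgeConjecture.Cruxes.H413.F0P3cDyRamDiagonalOrbitFibreCount
open scoped Valued WithZero Matrix MatrixGroups

variable {K : Type*} [Field K] [Valued K ℤᵐ⁰]

open Classical in
/-- **(O2b) CLASS BY CLASS.**  For every sign class `e`: `Σᶠ_{M ∈ 𝒯·M₀} #{a : diag(ϖu^{a})·M is a type-tv vertex of diag(d_e)} = [latticeStabilizer M₀ : H]` if `w⁻¹c^{e} ∈ N(𝒯) ⊔ S_F(M₀)`
and `0` otherwise (`H = 𝒯 ⊓ N⁻¹(S_F(M₀))`, `D₁ = N(ϖu^{a₀})·w` the given polarisation, `(c^{e})_j = cU` if `e j` else `1`); and the INDEX IDENTITY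
`#{e | w⁻¹c^{e} ∈ N(𝒯) ⊔ S_F(M₀)} · [latticeStabilizer M₀ : H] · [𝒰 : S_F(M₀)] = 8 · [𝒯 : S̃(M₀)]` (★ PART 1).  Proof = ★ (O2b) PART 3 steps (1)–(7) verbatim.
[cite: Kottwitz1986BaseChangeUnits, §1 pp. 240–241] [cite: Rogawski1990, §4.9 Prop. 4.9.1 (a) p. 55] [cite: Serre1979, Ch. V §3] -/
theorem finsum_ncard_fibre_class_eq_and_index {σ : K →+* K} (hσ : ∀ x, σ (σ x) = x) (hvσ : ∀ a, Valued.v (σ a) = Valued.v a)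
    {ϖ : K} (hϖ : Valued.v ϖ = WithZero.exp (-1 : ℤ)) (ϖu : Kˣ) (hϖu : (ϖu : K) = ϖ)
    {c : K} (hσc : σ c = c) (hcv : Valued.v c = 1) (hc : ¬ ∃ z : K, z * σ z = c)
    (hdich : ∀ x : K, σ x = x → x ≠ 0 → (∃ z : K, z * σ z = x) ∨ ∃ z : K, z * σ z = c * x) (cU : Kˣ) (hcU : (cU : K) = c)
    {M₀ : Submodule 𝒪[K] (Fin 3 → K)}
    (hfin : {M : Submodule 𝒪[K] (Fin 3 → K) | ∃ u ∈ unitTorus K 3, M = mapGL (diagGLUnits u) M₀}.Finite) (tv : ℕ)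
    (hcoset : ∀ D₁ : Fin 3 → K, (∀ i, σ (D₁ i) = D₁ i ∧ D₁ i ≠ 0) → IsVertexLattice σ ϖ (Matrix.diagonal D₁) tv M₀ →
      ∀ D : Fin 3 → K, (∀ i, σ (D i) = D i ∧ D i ≠ 0) →
        (IsVertexLattice σ ϖ (Matrix.diagonal D) tv M₀ ↔ ∃ u ∈ fixedUnitStabilizer σ M₀, ∀ i, D i = D₁ i * (u i : Kˣ)))
    {D₁ : Fin 3 → K} (hD₁ : ∀ i, σ (D₁ i) = D₁ i ∧ D₁ i ≠ 0) (hV₁ : IsVertexLattice σ ϖ (Matrix.diagonal D₁) tv M₀)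
    {a₀ : Fin 3 → ℤ} {w : Fin 3 → Kˣ} (hwU : w ∈ fixedUnitTorus σ 3)
    (hD₁w : ∀ i, D₁ i = (unitNormMap σ 3 (fun j => ϖu ^ a₀ j) i : Kˣ) * (w i : Kˣ)) :
    (∀ e : Fin 3 → Bool,
      (∑ᶠ M ∈ {M : Submodule 𝒪[K] (Fin 3 → K) | ∃ u ∈ unitTorus K 3, M = mapGL (diagGLUnits u) M₀},
          ({a : Fin 3 → ℤ | IsVertexLattice σ ϖ (Matrix.diagonal fun j => if e j then c else (1 : K)) tv
            (mapGL (diagGLUnits fun j => ϖu ^ a j) M)} : Set _).ncard) =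
        if w⁻¹ * (fun j => if e j then cU else 1) ∈ (unitTorus K 3).map (unitNormMap σ 3) ⊔ latticeStabilizer M₀ ⊓ fixedUnitTorus σ 3
        then (latticeStabilizer M₀).relIndex (unitTorus K 3 ⊓ (latticeStabilizer M₀ ⊓ fixedUnitTorus σ 3).comap (unitNormMap σ 3)) else 0) ∧
    ({e : Fin 3 → Bool | w⁻¹ * (fun j => if e j then cU else 1) ∈ (unitTorus K 3).map (unitNormMap σ 3) ⊔ latticeStabilizer M₀ ⊓ fixedUnitTorus σ 3}.ncard *
        (latticeStabilizer M₀).relIndex (unitTorus K 3 ⊓ (latticeStabilizer M₀ ⊓ fixedUnitTorus σ 3).comap (unitNormMap σ 3)) *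
        (latticeStabilizer M₀ ⊓ fixedUnitTorus σ 3).relIndex (fixedUnitTorus σ 3) =
      8 * (latticeStabilizer M₀ ⊓ unitTorus K 3).relIndex (unitTorus K 3)) := by
  classical
  have hc0 : c ≠ 0 := fun h => by simp [h] at hcv
  set Orb : Set (Submodule 𝒪[K] (Fin 3 → K)) := {M | ∃ u ∈ unitTorus K 3, M = mapGL (diagGLUnits u) M₀} with hOrb
  -- coordinatewise check of identities in `(K^×)³`
  have upi : ∀ {x y : Fin 3 → Kˣ}, (∀ i, ((x i : Kˣ) : K) = y i) → x = y := fun h => funext fun i => Units.ext (h i)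
  set cvec : (Fin 3 → Bool) → (Fin 3 → Kˣ) := fun e i => if e i then cU else 1 with hcvec
  have hcvec_val : ∀ e i, ((cvec e i : Kˣ) : K) = if e i then c else 1 := by
    intro e i; by_cases h : e i <;> simp [hcvec, h, hcU]
  have hcvec_ne : ∀ (e : Fin 3 → Bool) i, (if e i then c else (1 : K)) ≠ 0 := by
    intro e i; by_cases h : e i <;> simp [h, hc0]
  have hcvec_v : ∀ (e : Fin 3 → Bool) i, Valued.v (if e i then c else (1 : K)) = 1 := by
    intro e i; by_cases h : e i <;> simp [h, hcv]
  have hcvec_fix : ∀ (e : Fin 3 → Bool) i, σ (if e i then c else (1 : K)) = if e i then c else 1 := by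
    intro e i; by_cases h : e i <;> simp [h, hσc]
  have hcvecU : ∀ e, cvec e ∈ fixedUnitTorus σ 3 := by
    intro e
    rw [mem_fixedUnitTorus_iff]
    exact ⟨fun i => by rw [hcvec_val]; exact hcvec_v e i, fun i => by rw [hcvec_val]; exact hcvec_fix e i⟩
  have hUT : fixedUnitTorus σ 3 ≤ unitTorus K 3 := fun x hx => ((mem_fixedUnitTorus_iff σ x).1 hx).1
  have hNT : (unitTorus K 3).map (unitNormMap σ 3) ≤ fixedUnitTorus σ 3 := map_unitNormMap_unitTorus_le hσ hvσ
  -- the decomposition `D₁ = N(ϖu^{a₀}) · w`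
  have hwU' := (mem_fixedUnitTorus_iff σ w).1 hwU
  -- Step 1: `N(S̃) ≤ S_F`
  have hNS : (latticeStabilizer M₀ ⊓ unitTorus K 3).map (unitNormMap σ 3) ≤ latticeStabilizer M₀ ⊓ fixedUnitTorus σ 3 := by
    rintro _ ⟨s, hs, rfl⟩
    have hs' := Subgroup.mem_inf.1 hs
    have hsS : mapGL (diagGLUnits s) M₀ = M₀ := (mem_latticeStabilizer_iff M₀ s).1 hs'.1
    have hV' : IsVertexLattice σ ϖ (Matrix.diagonal D₁) tv (mapGL (diagGLUnits s) M₀) := by rw [hsS]; exact hV₁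
    rw [isVertexLattice_diagonal_mapGL_diagGLUnits_iff] at hV'
    have hDfix : ∀ i, σ (D₁ i * ((s i : K) * σ (s i))) = D₁ i * ((s i : K) * σ (s i)) ∧ D₁ i * ((s i : K) * σ (s i)) ≠ 0 := fun i =>
      ⟨by rw [map_mul, map_mul, (hD₁ i).1, hσ, mul_comm (σ (s i : K))],
        mul_ne_zero (hD₁ i).2 (mul_ne_zero (s i).ne_zero ((map_ne_zero σ).2 (s i).ne_zero))⟩
    obtain ⟨u, huSF, hu⟩ := (hcoset D₁ hD₁ hV₁ _ hDfix).1 hV'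
    have heq : unitNormMap σ 3 s = u := upi fun i => by
      rw [unitNormMap_apply]; exact mul_left_cancel₀ (hD₁ i).2 (hu i)
    rw [heq]; exact huSF
  -- Step 2: the fibre along `diag(u)·M₀`: `a` is in the `e`-fibre iff `a = a₀` and `c^e·N(u)·w⁻¹ ∈ S_F`
  have step2 : ∀ u ∈ unitTorus K 3, ∀ (e : Fin 3 → Bool) (a : Fin 3 → ℤ),
      IsVertexLattice σ ϖ (Matrix.diagonal fun i => if e i then c else (1 : K)) tv
          (mapGL (diagGLUnits fun i => ϖu ^ a i) (mapGL (diagGLUnits u) M₀)) ↔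
        a = a₀ ∧ cvec e * unitNormMap σ 3 u * w⁻¹ ∈ fixedUnitStabilizer σ M₀ := by
    intro u hu e a
    rw [← mapGL_mul, ← map_mul, isVertexLattice_diagonal_mapGL_diagGLUnits_iff]
    have hDfix : ∀ i, σ ((if e i then c else (1 : K)) * ((((fun j => ϖu ^ a j) * u) i : Kˣ) * σ (((fun j => ϖu ^ a j) * u) i : Kˣ)))
        = (if e i then c else (1 : K)) * ((((fun j => ϖu ^ a j) * u) i : Kˣ) * σ (((fun j => ϖu ^ a j) * u) i : Kˣ)) ∧
        (if e i then c else (1 : K)) * ((((fun j => ϖu ^ a j) * u) i : Kˣ) * σ (((fun j => ϖu ^ a j) * u) i : Kˣ)) ≠ 0 := fun i =>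
      ⟨by rw [map_mul, map_mul, hcvec_fix, hσ, mul_comm (σ _) (_ : K)],
        mul_ne_zero (hcvec_ne e i) (mul_ne_zero (Units.ne_zero _) ((map_ne_zero σ).2 (Units.ne_zero _)))⟩
    rw [hcoset D₁ hD₁ hV₁ _ hDfix]
    have key : ∀ s : Fin 3 → Kˣ, (∀ i, (if e i then c else (1 : K)) * ((((fun j => ϖu ^ a j) * u) i : Kˣ) * σ (((fun j => ϖu ^ a j) * u) i : Kˣ))
          = D₁ i * (s i : Kˣ)) ↔
        unitNormMap σ 3 (fun j => ϖu ^ a j) * (cvec e * unitNormMap σ 3 u) = unitNormMap σ 3 (fun j => ϖu ^ a₀ j) * (w * s) := by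
      intro s
      constructor
      · intro h
        refine upi fun i => ?_
        have := h i
        rw [hD₁w i, unitNormMap_apply, Pi.mul_apply, Units.val_mul, map_mul] at this
        simp only [Pi.mul_apply, Units.val_mul, unitNormMap_apply, hcvec_val]
        linear_combination this
      · intro h i
        have := congrArg (fun f : Fin 3 → Kˣ => ((f i : Kˣ) : K)) h
        simp only [Pi.mul_apply, Units.val_mul, unitNormMap_apply, hcvec_val] at this
        rw [hD₁w i, unitNormMap_apply, Pi.mul_apply, Units.val_mul, map_mul]
        linear_combination this
    constructor
    · rintro ⟨s, hsSF, hs⟩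
      rw [key] at hs
      have hsU := ((mem_fixedUnitStabilizer_iff σ M₀ s).1 hsSF).2.1
      have ha : a = a₀ := by
        funext i
        have := congrArg (fun f : Fin 3 → Kˣ => Valued.v ((f i : Kˣ) : K)) hs
        simp only [Pi.mul_apply, Units.val_mul, map_mul] at this
        rw [hcvec_val, hcvec_v, v_unitNormMap_zpow hvσ hϖ ϖu hϖu, v_unitNormMap_of_mem_unitTorus hvσ hu,
          v_unitNormMap_zpow hvσ hϖ ϖu hϖu, hwU'.1 i, hsU i] at this
        simp only [mul_one, WithZero.exp_inj] at this
        omega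
      subst ha
      refine ⟨rfl, ?_⟩
      have hs2 : cvec e * unitNormMap σ 3 u = w * s := mul_left_cancel hs
      rw [hs2, mul_inv_cancel_comm]
      exact hsSF
    · rintro ⟨rfl, hmem⟩
      refine ⟨cvec e * unitNormMap σ 3 u * w⁻¹, hmem, ?_⟩
      rw [key, mul_inv_cancel_comm_assoc]
  -- Step 3: the condition is constant along the `S̃`-coset of `u`
  have step3 : ∀ u ∈ unitTorus K 3, ∀ u' ∈ unitTorus K 3, mapGL (diagGLUnits u) M₀ = mapGL (diagGLUnits u') M₀ →
      ∀ e : Fin 3 → Bool, cvec e * unitNormMap σ 3 u * w⁻¹ ∈ fixedUnitStabilizer σ M₀ →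
        cvec e * unitNormMap σ 3 u' * w⁻¹ ∈ fixedUnitStabilizer σ M₀ := by
    intro u hu u' hu' heq e h
    have hst : u⁻¹ * u' ∈ latticeStabilizer M₀ ⊓ unitTorus K 3 := by
      refine Subgroup.mem_inf.2 ⟨?_, (unitTorus K 3).mul_mem ((unitTorus K 3).inv_mem hu) hu'⟩
      rw [mem_latticeStabilizer_iff, map_mul, mapGL_mul, ← heq, ← mapGL_mul, ← map_mul, inv_mul_cancel, map_one, mapGL_one]
    have hn : unitNormMap σ 3 (u⁻¹ * u') ∈ fixedUnitStabilizer σ M₀ := hNS (Subgroup.mem_map_of_mem _ hst)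
    have hid : cvec e * unitNormMap σ 3 u' * w⁻¹ = (cvec e * unitNormMap σ 3 u * w⁻¹) * unitNormMap σ 3 (u⁻¹ * u') := by
      rw [map_mul, map_inv]
      refine upi fun i => ?_
      simp only [Pi.mul_apply, Pi.inv_apply, Units.val_mul, Units.val_inv_eq_inv_val]
      field_simp
    rw [hid]
    exact (fixedUnitStabilizer σ M₀).mul_mem h hn
  -- Step 4: `B e` = the lattices of the orbit counted at sign `e`; the `e`-fibre sum over the orbit is `#(B e)`
  set B : (Fin 3 → Bool) → Set (Submodule 𝒪[K] (Fin 3 → K)) := fun e =>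
    {M | ∃ u ∈ unitTorus K 3, M = mapGL (diagGLUnits u) M₀ ∧ cvec e * unitNormMap σ 3 u * w⁻¹ ∈ fixedUnitStabilizer σ M₀} with hB
  have hBsub : ∀ e, B e ⊆ Orb := by
    rintro e M ⟨u, hu, rfl, -⟩; exact ⟨u, hu, rfl⟩
  have hFib : ∀ (e : Fin 3 → Bool), ∀ u ∈ unitTorus K 3,
      ({a : Fin 3 → ℤ | IsVertexLattice σ ϖ (Matrix.diagonal fun j => if e j then c else (1 : K)) tv
          (mapGL (diagGLUnits fun j => ϖu ^ a j) (mapGL (diagGLUnits u) M₀))} : Set _).ncard =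
        if mapGL (diagGLUnits u) M₀ ∈ B e then 1 else 0 := by
    intro e u hu
    have hmemB : mapGL (diagGLUnits u) M₀ ∈ B e ↔ cvec e * unitNormMap σ 3 u * w⁻¹ ∈ fixedUnitStabilizer σ M₀ := by
      constructor
      · rintro ⟨u', hu', heq, hmem⟩
        exact step3 u' hu' u hu heq.symm e hmem
      · intro hmem
        exact ⟨u, hu, rfl, hmem⟩
    split_ifs with hgood
    · have hset : ({a : Fin 3 → ℤ | IsVertexLattice σ ϖ (Matrix.diagonal fun j => if e j then c else (1 : K)) tv
          (mapGL (diagGLUnits fun j => ϖu ^ a j) (mapGL (diagGLUnits u) M₀))} : Set _) = {a₀} := by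
        ext a
        rw [Set.mem_setOf_eq, Set.mem_singleton_iff, step2 u hu e a]
        exact ⟨fun h => h.1, fun h => ⟨h, hmemB.1 hgood⟩⟩
      rw [hset, Set.ncard_singleton]
    · have hset : ({a : Fin 3 → ℤ | IsVertexLattice σ ϖ (Matrix.diagonal fun j => if e j then c else (1 : K)) tv
          (mapGL (diagGLUnits fun j => ϖu ^ a j) (mapGL (diagGLUnits u) M₀))} : Set _) = ∅ := by
        ext a
        rw [Set.mem_setOf_eq, Set.mem_empty_iff_false, iff_false, step2 u hu e a]
        exact fun h => hgood (hmemB.2 h.2)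
      rw [hset, Set.ncard_empty]
  have hcount : ∀ e : Fin 3 → Bool, (∑ᶠ M ∈ Orb, ({a : Fin 3 → ℤ |
      IsVertexLattice σ ϖ (Matrix.diagonal fun j => if e j then c else (1 : K)) tv (mapGL (diagGLUnits fun j => ϖu ^ a j) M)} : Set _).ncard) =
        (B e).ncard := by
    intro e
    have h1 : (∑ᶠ M ∈ Orb, ({a : Fin 3 → ℤ |
        IsVertexLattice σ ϖ (Matrix.diagonal fun j => if e j then c else (1 : K)) tv (mapGL (diagGLUnits fun j => ϖu ^ a j) M)} : Set _).ncard) =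
          ∑ᶠ M ∈ Orb, (if M ∈ B e then 1 else 0) := by
      refine finsum_mem_congr rfl ?_
      rintro M ⟨u, hu, rfl⟩
      exact hFib e u hu
    rw [h1, finsum_mem_eq_finite_toFinset_sum _ hfin, ← Finset.card_filter, Set.ncard_eq_toFinset_card _ (hfin.subset (hBsub e))]
    congr 1
    ext M
    simp only [Finset.mem_filter, Set.Finite.mem_toFinset]
    exact ⟨fun h => h.2, fun h => ⟨hBsub e h, h⟩⟩
  -- Step 5: for each `e`, `B e` is empty or ONE translate of the `H`-orbit, `H = 𝒯 ∩ N⁻¹(S_F)`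
  set H : Subgroup (Fin 3 → Kˣ) := unitTorus K 3 ⊓ (latticeStabilizer M₀ ⊓ fixedUnitTorus σ 3).comap (unitNormMap σ 3) with hH
  have hBcount : ∀ e, (B e).ncard =
      if (∃ u₀ ∈ unitTorus K 3, cvec e * unitNormMap σ 3 u₀ * w⁻¹ ∈ fixedUnitStabilizer σ M₀) then (latticeStabilizer M₀).relIndex H else 0 := by
    intro e
    split_ifs with hgood
    · obtain ⟨u₀, hu₀, h₀⟩ := hgood
      have hBe : B e = {M | ∃ h ∈ H, M = mapGL (diagGLUnits (u₀ * h)) M₀} := by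
        ext M
        simp only [Set.mem_setOf_eq]
        constructor
        · rintro ⟨u, hu, rfl, h⟩
          refine ⟨u₀⁻¹ * u, ?_, by rw [mul_inv_cancel_left]⟩
          rw [hH]
          refine Subgroup.mem_inf.2 ⟨(unitTorus K 3).mul_mem ((unitTorus K 3).inv_mem hu₀) hu, ?_⟩
          rw [Subgroup.mem_comap]
          have hid : unitNormMap σ 3 (u₀⁻¹ * u) = (cvec e * unitNormMap σ 3 u₀ * w⁻¹)⁻¹ * (cvec e * unitNormMap σ 3 u * w⁻¹) := by
            rw [map_mul, map_inv]
            refine upi fun i => ?_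
            simp only [Pi.mul_apply, Pi.inv_apply, Units.val_mul, Units.val_inv_eq_inv_val]
            field_simp
          rw [hid]
          exact (fixedUnitStabilizer σ M₀).mul_mem ((fixedUnitStabilizer σ M₀).inv_mem h₀) h
        · rintro ⟨h, hh, rfl⟩
          rw [hH] at hh
          obtain ⟨hhT, hhN⟩ := Subgroup.mem_inf.1 hh
          rw [Subgroup.mem_comap] at hhN
          refine ⟨u₀ * h, (unitTorus K 3).mul_mem hu₀ hhT, rfl, ?_⟩
          have hid : cvec e * unitNormMap σ 3 (u₀ * h) * w⁻¹ = (cvec e * unitNormMap σ 3 u₀ * w⁻¹) * unitNormMap σ 3 h := by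
            rw [map_mul]
            refine upi fun i => ?_
            simp only [Pi.mul_apply, Pi.inv_apply, Units.val_mul, Units.val_inv_eq_inv_val]
            field_simp
          rw [hid]
          exact (fixedUnitStabilizer σ M₀).mul_mem h₀ hhN
      rw [hBe, ncard_translate_subgroup_orbit_eq_relIndex]
    · have hBe : B e = ∅ := by
        ext M
        simp only [Set.mem_empty_iff_false, iff_false]
        rintro ⟨u, hu, -, h⟩
        exact hgood ⟨u, hu, h⟩
      rw [hBe, Set.ncard_empty]
  -- Step 6: which `e` occur: `∃ u₀` iff `w⁻¹·c^e ∈ N(𝒯) ⊔ S_F`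
  have hgood_iff : ∀ e, (∃ u₀ ∈ unitTorus K 3, cvec e * unitNormMap σ 3 u₀ * w⁻¹ ∈ fixedUnitStabilizer σ M₀) ↔
      w⁻¹ * cvec e ∈ (unitTorus K 3).map (unitNormMap σ 3) ⊔ latticeStabilizer M₀ ⊓ fixedUnitTorus σ 3 := by
    intro e
    constructor
    · rintro ⟨u₀, hu₀, h⟩
      have hid : w⁻¹ * cvec e = unitNormMap σ 3 u₀⁻¹ * (cvec e * unitNormMap σ 3 u₀ * w⁻¹) := by
        rw [map_inv]
        refine upi fun i => ?_
        simp only [Pi.mul_apply, Pi.inv_apply, Units.val_mul, Units.val_inv_eq_inv_val]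
        field_simp
      rw [hid]
      exact Subgroup.mul_mem _ (Subgroup.mem_sup_left (Subgroup.mem_map_of_mem _ ((unitTorus K 3).inv_mem hu₀))) (Subgroup.mem_sup_right h)
    · intro h
      obtain ⟨y, hy, z, hz, hyz⟩ := Subgroup.mem_sup.1 h
      obtain ⟨t, ht, rfl⟩ := hy
      refine ⟨t⁻¹, (unitTorus K 3).inv_mem ht, ?_⟩
      have hid : cvec e * unitNormMap σ 3 t⁻¹ * w⁻¹ = (unitNormMap σ 3 t)⁻¹ * (w⁻¹ * cvec e) := by
        rw [map_inv]
        refine upi fun i => ?_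
        simp only [Pi.mul_apply, Pi.inv_apply, Units.val_mul, Units.val_inv_eq_inv_val]
        field_simp
      rw [hid, ← hyz, inv_mul_cancel_left]
      exact hz
  -- Step 7: the representatives count (PART 1) — `#{e good} = [N𝒯 ⊔ S_F : N𝒯]` and `[𝒰 : N𝒯] = 8`
  have hrep : ∀ x ∈ fixedUnitTorus σ 3, ∃! e : Fin 3 → Bool, x * (cvec e)⁻¹ ∈ (unitTorus K 3).map (unitNormMap σ 3) :=
    fun x hx => existsUnique_signVector_mem_map_unitNormMap hvσ hσc hcv hc hdich cU hcU x hx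
  have hXU : (unitTorus K 3).map (unitNormMap σ 3) ⊔ latticeStabilizer M₀ ⊓ fixedUnitTorus σ 3 ≤ fixedUnitTorus σ 3 :=
    sup_le hNT inf_le_right
  have hgood_card : (Finset.univ.filter fun e : Fin 3 → Bool =>
        ∃ u₀ ∈ unitTorus K 3, cvec e * unitNormMap σ 3 u₀ * w⁻¹ ∈ fixedUnitStabilizer σ M₀).card =
      ((unitTorus K 3).map (unitNormMap σ 3)).relIndex ((unitTorus K 3).map (unitNormMap σ 3) ⊔ latticeStabilizer M₀ ⊓ fixedUnitTorus σ 3) := by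
    rw [← card_filter_mem_coset_eq_relIndex ((unitTorus K 3).map (unitNormMap σ 3)) _ (fixedUnitTorus σ 3) le_sup_left hXU cvec hcvecU hrep w hwU]
    congr 1
    ext e
    simp only [Finset.mem_filter, Finset.mem_univ, true_and]
    exact hgood_iff e
  have h8 : ((unitTorus K 3).map (unitNormMap σ 3)).relIndex (fixedUnitTorus σ 3) = 8 := by
    rw [← card_filter_mem_coset_eq_relIndex ((unitTorus K 3).map (unitNormMap σ 3)) (fixedUnitTorus σ 3) (fixedUnitTorus σ 3) hNT le_rfl
      cvec hcvecU hrep 1 (Subgroup.one_mem _)]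
    rw [Finset.filter_true_of_mem (fun e _ => by rw [inv_one, one_mul]; exact hcvecU e)]
    simp
  have hSH : (latticeStabilizer M₀).relIndex H = (latticeStabilizer M₀ ⊓ unitTorus K 3).relIndex H := by
    rw [← Subgroup.inf_relIndex_right (latticeStabilizer M₀ ⊓ unitTorus K 3) H, ← Subgroup.inf_relIndex_right (latticeStabilizer M₀) H]
    congr 1
    rw [inf_assoc, inf_eq_right.2 (inf_le_left : H ≤ unitTorus K 3)]
  have hidx := relIndex_map_sup_mul_relIndex_comap_mul_relIndex_eq (unitTorus K 3) (fixedUnitTorus σ 3) (latticeStabilizer M₀)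
    (unitNormMap σ 3) hNT hNS
  rw [h8, ← hgood_card, ← hH, ← hSH] at hidx
  refine ⟨fun e => ?_, ?_⟩
  · rw [hcount e, hBcount e]
    exact if_congr (hgood_iff e) rfl rfl
  · have hcard : ({e : Fin 3 → Bool | w⁻¹ * cvec e ∈ (unitTorus K 3).map (unitNormMap σ 3) ⊔ latticeStabilizer M₀ ⊓ fixedUnitTorus σ 3}.ncard) =
        (Finset.univ.filter fun e : Fin 3 → Bool =>
          ∃ u₀ ∈ unitTorus K 3, cvec e * unitNormMap σ 3 u₀ * w⁻¹ ∈ fixedUnitStabilizer σ M₀).card := by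
      rw [Set.ncard_eq_toFinset_card']
      congr 1
      ext e
      simp only [Set.mem_toFinset, Set.mem_setOf_eq, Finset.mem_filter, Finset.mem_univ, true_and]
      exact (hgood_iff e).symm
    rw [hcard]
    exact hidx

end Summit.HodgeConjecture.HodgeConjecture.Cruxes.H413.F0P3cDyRamDiagonalOrbitFibreClassCount

end
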